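import Summits.NavierStokesRegularity.NavierStokesRegularity.Theorems.LerayQuarterDissipationFiniteDissipationLiouvilleEnergyRemainder
import HarnessLib

/-!
# Crux `FiniteDissipationLiouville` (stmt-NavierStokesRegularity-22144): the finite-energy remainder
# is energetically LOCAL (`O(t²)` outside any ball) and the trajectory lives in the affine energy
# space `u₀ + L²(ℝ³)`

Theorems file of route `LerayQuarterDissipation` (lead prover ns-lqd-lead g9; `--supports` the
crux, line `birth`; corollaries of `…EnergyRemainder`). Navier–Stokes regularity is NOT proved by
anything here; no summit is.

* `lintegral_compl_ball_sub_finalDatum_sq_le` — under the final-datum rate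
  `‖W(t,x) − u₀(x)‖ ≤ L₀(−t)/‖x‖³` (lead g7), for every `R > 0`:
  `∫_{‖x‖ ≥ R} ‖W(t) − u₀‖² ≤ |B₁| L₀² (−t)² / R³` — all but `O(t²)` of the `O(√(−t))` energy of the
  singular part sits inside any fixed ball around the apex.
* `eLpNorm_sub_slices_le` — the slices of a Type-I profile differ PAIRWISE by finite-energy
  fields, `‖W(t) − W(s)‖_{L²(ℝ³)} ≤ √(M√(−t)) + √(M√(−s))`, although no slice has finite energy:
  the trajectory `t ↦ W(t)` is a curve in the affine energy space `u₀ + L²(ℝ³)`, Hölder-`¼` into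
  `L²` at the singular time, where it attains `u₀`.

Portrait facts; no scenario removed; no summit proved.
-/

noncomputable section

-- the summit and its single sub-problem share the name (CONVENTIONS §1), as in every Theorems file
set_option linter.dupNamespace false

namespace Summit.NavierStokesRegularity.NavierStokesRegularity.Theorems.FiniteDissipationLiouville.EnergyRemainder

open MeasureTheory Set Filter Topology Metric Function
open Literature.Analysis Literature.Analysis.FluidPDE
open Summit.NavierStokesRegularity.NavierStokesRegularity.Theorems.FiniteDissipationLiouville
open Summit.NavierStokesRegularity.NavierStokesRegularity.Theorems
open scoped ENNReal NNReal RealInnerProductSpace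

/-! ### Locality of the remainder energy; the affine energy space -/

/-- **The far-field energy of the remainder is `O(t²)`.** Under the rate
`‖W(t,x) − u₀(x)‖ ≤ L₀(−t)/‖x‖³` off the apex, for every `R > 0` and `t < 0`:
`∫_{‖x‖ ≥ R} ‖W(t) − u₀‖² ≤ |B₁| L₀² (−t)² / R³`. So all but `O(t²)` of the (already `O(√(−t))`)
energy of the singular part sits inside any fixed ball around the apex: the singularity is
energetically local. -/
theorem lintegral_compl_ball_sub_finalDatum_sq_le {L₀ : ℝ}
    {W : ℝ → EuclideanSpace ℝ (Fin 3) → EuclideanSpace ℝ (Fin 3)}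
    {u₀ : EuclideanSpace ℝ (Fin 3) → EuclideanSpace ℝ (Fin 3)}
    (hrate : ∀ x : EuclideanSpace ℝ (Fin 3), x ≠ 0 → ∀ t : ℝ, t < 0 →
      ‖W t x - u₀ x‖ ≤ L₀ * (-t) / ‖x‖ ^ 3) {R : ℝ} (hR : 0 < R) {t : ℝ} (ht : t < 0) :
    ∫⁻ x in (ball (0 : EuclideanSpace ℝ (Fin 3)) R)ᶜ, ‖W t x - u₀ x‖ₑ ^ 2 ≤
      ENNReal.ofReal ((volume : Measure (EuclideanSpace ℝ (Fin 3))).real (ball 0 1) *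
        L₀ ^ 2 * (-t) ^ 2 / R ^ 3) := by
  have hout : ∀ x : EuclideanSpace ℝ (Fin 3), R ≤ ‖x‖ → ‖W t x - u₀ x‖ₑ ^ 2 ≤
      ENNReal.ofReal (L₀ ^ 2 * (-t) ^ 2) * ENNReal.ofReal (‖x‖ ^ (-(6 : ℝ))) := by
    intro x hx
    have hxpos : 0 < ‖x‖ := hR.trans_le hx
    have hx0 : x ≠ 0 := norm_pos_iff.1 hxpos
    have h1 := hrate x hx0 t ht
    have hnn : 0 ≤ L₀ * (-t) / ‖x‖ ^ 3 := (norm_nonneg _).trans h1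
    have e : ‖x‖ ^ (-(6 : ℝ)) = (‖x‖ ^ 6)⁻¹ := by
      rw [Real.rpow_neg hxpos.le, show (6 : ℝ) = ((6 : ℕ) : ℝ) by norm_num, Real.rpow_natCast]
    have h2 : ‖W t x - u₀ x‖ ^ 2 ≤ L₀ ^ 2 * (-t) ^ 2 * ‖x‖ ^ (-(6 : ℝ)) := by
      rw [e]
      calc ‖W t x - u₀ x‖ ^ 2 ≤ (L₀ * (-t) / ‖x‖ ^ 3) ^ 2 :=
            pow_le_pow_left₀ (norm_nonneg _) h1 2
        _ = L₀ ^ 2 * (-t) ^ 2 * (‖x‖ ^ 6)⁻¹ := by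
            field_simp
    calc ‖W t x - u₀ x‖ₑ ^ 2 = ENNReal.ofReal (‖W t x - u₀ x‖ ^ 2) := by
          rw [← ofReal_norm, ENNReal.ofReal_pow (norm_nonneg _)]
      _ ≤ ENNReal.ofReal (L₀ ^ 2 * (-t) ^ 2 * ‖x‖ ^ (-(6 : ℝ))) := ENNReal.ofReal_le_ofReal h2
      _ = _ := ENNReal.ofReal_mul (by positivity)
  calc ∫⁻ x in (ball (0 : EuclideanSpace ℝ (Fin 3)) R)ᶜ, ‖W t x - u₀ x‖ₑ ^ 2
      ≤ ∫⁻ x in (ball (0 : EuclideanSpace ℝ (Fin 3)) R)ᶜ,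
          ENNReal.ofReal (L₀ ^ 2 * (-t) ^ 2) * ENNReal.ofReal (‖x‖ ^ (-(6 : ℝ))) := by
        refine lintegral_mono_ae (ae_restrict_of_forall_mem measurableSet_ball.compl fun x hx => ?_)
        refine hout x ?_
        rw [mem_compl_iff, mem_ball_zero_iff, not_lt] at hx
        exact hx
    _ = ENNReal.ofReal (L₀ ^ 2 * (-t) ^ 2) *
          ENNReal.ofReal (3 * (volume : Measure (EuclideanSpace ℝ (Fin 3))).real (ball 0 1) *
            (R ^ ((3 : ℝ) - 6) / (6 - 3))) := by
        rw [lintegral_const_mul' _ _ ENNReal.ofReal_ne_top,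
          NewtonPotentialHolder.lintegral_compl_ball_norm_rpow_neg (by norm_num) hR]
    _ = ENNReal.ofReal ((volume : Measure (EuclideanSpace ℝ (Fin 3))).real (ball 0 1) *
          L₀ ^ 2 * (-t) ^ 2 / R ^ 3) := by
        rw [← ENNReal.ofReal_mul (by positivity)]
        congr 1
        have e : R ^ ((3 : ℝ) - 6) = (R ^ 3)⁻¹ := by
          rw [show (3 : ℝ) - 6 = -((3 : ℕ) : ℝ) by norm_num, Real.rpow_neg hR.le, Real.rpow_natCast]
        rw [e]
        field_simp
        ring

/-- **The slices of a Type-I profile differ pairwise by finite-energy fields** (although no slice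
has finite energy): under the hypotheses of `lintegral_sub_finalDatum_sq_le`, for all `t, s < 0`
the field `W(t) − W(s)` lies in `L²(ℝ³)` with
`‖W(t) − W(s)‖_{L²} ≤ √(M√(−t)) + √(M√(−s))`, `M = 3|B₁|(2C²/3 + 2A² + L₀²/3)`. Together with
`lintegral_sub_finalDatum_sq_le`: the whole trajectory `t ↦ W(t)`, `t < 0`, is a curve in the
AFFINE ENERGY SPACE `u₀ + L²(ℝ³)`, Hölder-`¼` continuous into `L²` at the singular time, where it
attains `u₀`. -/
theorem eLpNorm_sub_slices_le {C A L₀ : ℝ}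
    {W : ℝ → EuclideanSpace ℝ (Fin 3) → EuclideanSpace ℝ (Fin 3)}
    {u₀ : EuclideanSpace ℝ (Fin 3) → EuclideanSpace ℝ (Fin 3)} (hW : IsTypeIAncientMild C W)
    (hu₀ : ∀ x : EuclideanSpace ℝ (Fin 3), x ≠ 0 → ‖u₀ x‖ ≤ A / ‖x‖)
    (hrate : ∀ x : EuclideanSpace ℝ (Fin 3), x ≠ 0 → ∀ t : ℝ, t < 0 →
      ‖W t x - u₀ x‖ ≤ L₀ * (-t) / ‖x‖ ^ 3) {t s : ℝ} (ht : t < 0) (hs : s < 0) :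
    MemLp (fun x => W t x - W s x) 2 (volume : Measure (EuclideanSpace ℝ (Fin 3))) ∧
    eLpNorm (fun x => W t x - W s x) 2 (volume : Measure (EuclideanSpace ℝ (Fin 3))) ≤
      ENNReal.ofReal (Real.sqrt (3 * (volume : Measure (EuclideanSpace ℝ (Fin 3))).real (ball 0 1) *
        (2 * C ^ 2 / 3 + 2 * A ^ 2 + L₀ ^ 2 / 3) * Real.sqrt (-t))) +
      ENNReal.ofReal (Real.sqrt (3 * (volume : Measure (EuclideanSpace ℝ (Fin 3))).real (ball 0 1) *
        (2 * C ^ 2 / 3 + 2 * A ^ 2 + L₀ ^ 2 / 3) * Real.sqrt (-s))) := by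
  set M : ℝ := 3 * (volume : Measure (EuclideanSpace ℝ (Fin 3))).real (ball 0 1) *
    (2 * C ^ 2 / 3 + 2 * A ^ 2 + L₀ ^ 2 / 3) with hM
  have hmt := memLp_two_sub_finalDatum hW hu₀ hrate t ht
  have hms := memLp_two_sub_finalDatum hW hu₀ hrate s hs
  have e : (fun x => W t x - W s x) = (fun x => W t x - u₀ x) - fun x => W s x - u₀ x := by
    funext x; simp only [Pi.sub_apply]; abel
  refine ⟨by rw [e]; exact hmt.sub hms, ?_⟩
  -- each remainder has `eLpNorm ≤ √(M √(−τ))`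
  have hbound : ∀ {τ : ℝ}, τ < 0 →
      eLpNorm (fun x => W τ x - u₀ x) 2 (volume : Measure (EuclideanSpace ℝ (Fin 3))) ≤
        ENNReal.ofReal (Real.sqrt (M * Real.sqrt (-τ))) := by
    intro τ hτ
    have h := lintegral_sub_finalDatum_sq_le hW hu₀ hrate τ hτ
    rw [← hM] at h
    have hM0 : 0 ≤ M * Real.sqrt (-τ) := by
      have hV : 0 ≤ M := by rw [hM]; positivity
      positivity
    rw [eLpNorm_eq_lintegral_rpow_enorm_toReal two_ne_zero ENNReal.ofNat_ne_top, ENNReal.toReal_ofNat]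
    have e2 : (fun x => ‖W τ x - u₀ x‖ₑ ^ (2 : ℝ)) = fun x => ‖W τ x - u₀ x‖ₑ ^ 2 := by
      funext x; rw [show (2 : ℝ) = ((2 : ℕ) : ℝ) by norm_num, ENNReal.rpow_natCast]
    rw [e2, Real.sqrt_eq_rpow, ← ENNReal.ofReal_rpow_of_nonneg hM0 (by norm_num)]
    exact ENNReal.rpow_le_rpow h (by norm_num)
  rw [e]
  exact (eLpNorm_sub_le hmt.1 hms.1 one_le_two).trans (add_le_add (hbound ht) (hbound hs))

end Summit.NavierStokesRegularity.NavierStokesRegularity.Theorems.FiniteDissipationLiouville.EnergyRemainder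

end
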